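import Mathlib
import Summits.Ventures.FusionMHD.Models.CerfonFreidbergIterLikeQHalfShearEnvelope
import HarnessLib

/-!
# Ventures/FusionMHD — Models/CerfonFreidbergIterLikeQHalfMercEnvelope.lean: TUBE ENVELOPES of the four F-independent Mercier kernels
# `K_W = (X_a + 2s cos θ)/D² − R s F2/D³`, `K_Aσ = R s/(D G)`, `K_R = R³ s/(D G)`, `K_B1 = s/(R D G)` — pure algebra (no instance object)

HONEST FRAMING (LADDER-GRIDFUSION three columns; CF rung, F2 item R2; «F2.R2-CF-MERCIER-IMPLICIT» step (4), infrastructure, LOW, no count).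
Elementary real inequalities in the style of `…QHalfShearEnvelope`: product envelopes for two and three factors (`prod2_env`, `prod3_env`), per-factor
facts on a tube (`|s − m| ≤ r`, `|R_s − R_m| ≤ r`, `|D_s − D_m| ≤ Mr`, `|F_s − F_m| ≤ M₃r`, `|G_s − G_m| ≤ M_G r`, with two-sided bounds `μ ≤ D ≤ ν`,
`X⁻ ≤ R ≤ X⁺`, `0 ≤ s ≤ s_max`, `|F| ≤ M`, `μ² ≤ G`), and the four kernel envelopes **`envW_bound`**, **`envS_bound`**, **`envR_bound`**, **`envB_bound`**
with explicit rational functions `envW/envS/envR/envB` stated over any field (shared with the per-panel rational check of `…QHalfMercLink`).  [folklore]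
throughout; nothing modelled.  Typer/prover: gridfusion-model-7 (g7), 2026-08-27.
-/

noncomputable section

set_option autoImplicit false

namespace Summit.Ventures.FusionMHD.Models.CFIterLike.QHalf

/-! ## §1 Product envelopes -/

/-- Two factors: `|x₁x₂ − y₁y₂| ≤ δ₁B₂ + B₁δ₂` from `|x₂| ≤ B₂`, `|y₁| ≤ B₁`, `|x₁ − y₁| ≤ δ₁`, `|x₂ − y₂| ≤ δ₂`. [folklore] -/
theorem prod2_env {x₁ x₂ y₁ y₂ B₁ B₂ δ₁ δ₂ : ℝ} (hB₁ : |y₁| ≤ B₁) (hB₂ : |x₂| ≤ B₂) (hδ₁ : |x₁ - y₁| ≤ δ₁) (hδ₂ : |x₂ - y₂| ≤ δ₂) :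
    |x₁ * x₂ - y₁ * y₂| ≤ δ₁ * B₂ + B₁ * δ₂ := by
  have h := Literature.Probability.Moments.abs_mul_sub_mul_le x₁ x₂ y₁ y₂
  have t1 : |x₁ - y₁| * |x₂| ≤ δ₁ * B₂ := mul_le_mul hδ₁ hB₂ (abs_nonneg _) ((abs_nonneg _).trans hδ₁)
  have t2 : |y₁| * |x₂ - y₂| ≤ B₁ * δ₂ := mul_le_mul hB₁ hδ₂ (abs_nonneg _) ((abs_nonneg _).trans hB₁)
  linarith

/-- Three factors: `|x₁x₂x₃ − y₁y₂y₃| ≤ (δ₁B₂ + B₁δ₂)B₃ + B₁B₂δ₃`. [folklore] -/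
theorem prod3_env {x₁ x₂ x₃ y₁ y₂ y₃ B₁ B₂ B₃ δ₁ δ₂ δ₃ : ℝ} (hx₂ : |x₂| ≤ B₂) (hx₃ : |x₃| ≤ B₃) (hy₁ : |y₁| ≤ B₁) (hy₂ : |y₂| ≤ B₂)
    (hδ₁ : |x₁ - y₁| ≤ δ₁) (hδ₂ : |x₂ - y₂| ≤ δ₂) (hδ₃ : |x₃ - y₃| ≤ δ₃) :
    |x₁ * x₂ * x₃ - y₁ * y₂ * y₃| ≤ (δ₁ * B₂ + B₁ * δ₂) * B₃ + B₁ * B₂ * δ₃ := by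
  have h12 := prod2_env hy₁ hx₂ hδ₁ hδ₂
  have hy12 : |y₁ * y₂| ≤ B₁ * B₂ := by
    rw [abs_mul]; exact mul_le_mul hy₁ hy₂ (abs_nonneg _) ((abs_nonneg _).trans hy₁)
  exact prod2_env hy12 hx₃ h12 hδ₃

/-! ## §2 Per-factor facts -/

/-- `|a³ − b³| ≤ 3 hi² δ` for `0 ≤ a, b ≤ hi`, `|a − b| ≤ δ`. [folklore] -/
theorem cube_sub_abs_le {a b hi δ : ℝ} (ha : 0 ≤ a) (hb : 0 ≤ b) (ha' : a ≤ hi) (hb' : b ≤ hi) (hab : |a - b| ≤ δ) :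
    |a ^ 3 - b ^ 3| ≤ 3 * hi ^ 2 * δ := by
  have hhi : 0 ≤ hi := ha.trans ha'
  have e : a ^ 3 - b ^ 3 = (a - b) * (a ^ 2 + a * b + b ^ 2) := by ring
  have hq : 0 ≤ a ^ 2 + a * b + b ^ 2 := by positivity
  have hq' : a ^ 2 + a * b + b ^ 2 ≤ 3 * hi ^ 2 := by
    nlinarith [mul_le_mul ha' ha' ha hhi, mul_le_mul ha' hb' hb hhi, mul_le_mul hb' hb' hb hhi]
  rw [e, abs_mul, abs_of_nonneg hq]
  calc |a - b| * (a ^ 2 + a * b + b ^ 2) ≤ δ * (3 * hi ^ 2) := mul_le_mul hab hq' hq ((abs_nonneg _).trans hab)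
    _ = 3 * hi ^ 2 * δ := by ring

/-- The reciprocal of a quantity `≥ lo > 0` is at most `1/lo` in absolute value. [folklore] -/
theorem abs_inv_le_of_le {a lo : ℝ} (hlo : 0 < lo) (ha : lo ≤ a) : |1 / a| ≤ 1 / lo := by
  have ha0 : 0 < a := hlo.trans_le ha
  rw [abs_of_pos (by positivity)]; exact one_div_le_one_div_of_le hlo ha

/-! ## §3 The four kernel envelopes -/

/-- Envelope formula of `K_W = (X_a + 2s cos θ)/D² − R s F2/D³`. -/
def envW {K : Type*} [Field K] (X r M M3 μ ν Xhi smax : K) : K :=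
  (2 * r * (1 / μ ^ 2) + (X + 2 * smax) * (2 * (M * r) * ν / μ ^ 4))
    + (((r * smax + Xhi * r) * M + Xhi * smax * (M3 * r)) * (1 / μ ^ 3) + Xhi * smax * M * (3 * (M * r) * ν ^ 2 / μ ^ 6))

/-- Envelope formula of `K_Aσ = R s/(D G)` (`G ≥ μ²`). -/
def envS {K : Type*} [Field K] (r M MG μ Xhi smax : K) : K :=
  ((r * smax + Xhi * r) * (1 / μ) + Xhi * smax * (M * r / μ ^ 2)) * (1 / μ ^ 2) + Xhi * smax * (1 / μ) * (MG * r / (μ ^ 2) ^ 2)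

/-- Envelope formula of `K_R = R³ s/(D G)`. -/
def envR {K : Type*} [Field K] (r M MG μ Xhi smax : K) : K :=
  ((3 * Xhi ^ 2 * r * smax + Xhi ^ 3 * r) * (1 / μ) + Xhi ^ 3 * smax * (M * r / μ ^ 2)) * (1 / μ ^ 2)
    + Xhi ^ 3 * smax * (1 / μ) * (MG * r / (μ ^ 2) ^ 2)

/-- Envelope formula of `K_B1 = s/(R D G)`. -/
def envB {K : Type*} [Field K] (r M MG μ Xlo smax : K) : K :=
  ((r * (1 / Xlo) + smax * (r / Xlo ^ 2)) * (1 / μ) + smax * (1 / Xlo) * (M * r / μ ^ 2)) * (1 / μ ^ 2)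
    + smax * (1 / Xlo) * (1 / μ) * (MG * r / (μ ^ 2) ^ 2)

/-- Cast of `envW`. -/
theorem envW_cast (X r M M3 μ ν Xhi smax : ℚ) :
    ((envW X r M M3 μ ν Xhi smax : ℚ) : ℝ) = envW (X : ℝ) (r : ℝ) (M : ℝ) (M3 : ℝ) (μ : ℝ) (ν : ℝ) (Xhi : ℝ) (smax : ℝ) := by
  unfold envW; push_cast; ring
/-- Cast of `envS`. -/
theorem envS_cast (r M MG μ Xhi smax : ℚ) :
    ((envS r M MG μ Xhi smax : ℚ) : ℝ) = envS (r : ℝ) (M : ℝ) (MG : ℝ) (μ : ℝ) (Xhi : ℝ) (smax : ℝ) := by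
  unfold envS; push_cast; ring
/-- Cast of `envR`. -/
theorem envR_cast (r M MG μ Xhi smax : ℚ) :
    ((envR r M MG μ Xhi smax : ℚ) : ℝ) = envR (r : ℝ) (M : ℝ) (MG : ℝ) (μ : ℝ) (Xhi : ℝ) (smax : ℝ) := by
  unfold envR; push_cast; ring
/-- Cast of `envB`. -/
theorem envB_cast (r M MG μ Xlo smax : ℚ) :
    ((envB r M MG μ Xlo smax : ℚ) : ℝ) = envB (r : ℝ) (M : ℝ) (MG : ℝ) (μ : ℝ) (Xlo : ℝ) (smax : ℝ) := by
  unfold envB; push_cast; ring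

section env

variable {Xa XB s m Rs Rm Ds Dm Fs Fm Gs Gm r M M3 MG μ ν Xlo Xhi smax : ℝ}

/-- Common tube hypotheses ⇒ the per-factor triples used by all four envelopes. [folklore] -/
theorem factor_facts (hμ : 0 < μ) (hXlo : 0 < Xlo)
    (hsm : |s - m| ≤ r) (hR : |Rs - Rm| ≤ r) (hD : |Ds - Dm| ≤ M * r) (hG : |Gs - Gm| ≤ MG * r)
    (hDs : μ ≤ Ds ∧ Ds ≤ ν) (hDm : μ ≤ Dm ∧ Dm ≤ ν) (hRs : Xlo ≤ Rs ∧ Rs ≤ Xhi) (hRm : Xlo ≤ Rm ∧ Rm ≤ Xhi)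
    (hs : 0 ≤ s ∧ s ≤ smax) (hm : 0 ≤ m ∧ m ≤ smax) (hGs : μ ^ 2 ≤ Gs) (hGm : μ ^ 2 ≤ Gm) :
    (|Rs * s| ≤ Xhi * smax ∧ |Rm * m| ≤ Xhi * smax ∧ |Rs * s - Rm * m| ≤ r * smax + Xhi * r)
    ∧ (|1 / Ds| ≤ 1 / μ ∧ |1 / Dm| ≤ 1 / μ ∧ |1 / Ds - 1 / Dm| ≤ M * r / μ ^ 2)
    ∧ (|1 / Gs| ≤ 1 / μ ^ 2 ∧ |1 / Gm| ≤ 1 / μ ^ 2 ∧ |1 / Gs - 1 / Gm| ≤ MG * r / (μ ^ 2) ^ 2)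
    ∧ (|Rs ^ 3 * s| ≤ Xhi ^ 3 * smax ∧ |Rm ^ 3 * m| ≤ Xhi ^ 3 * smax ∧ |Rs ^ 3 * s - Rm ^ 3 * m| ≤ 3 * Xhi ^ 2 * r * smax + Xhi ^ 3 * r)
    ∧ (|s * (1 / Rs)| ≤ smax * (1 / Xlo) ∧ |m * (1 / Rm)| ≤ smax * (1 / Xlo) ∧ |s * (1 / Rs) - m * (1 / Rm)| ≤ r * (1 / Xlo) + smax * (r / Xlo ^ 2)) := by
  have hRs0 : 0 < Rs := hXlo.trans_le hRs.1
  have hRm0 : 0 < Rm := hXlo.trans_le hRm.1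
  have hμ2 : 0 < μ ^ 2 := by positivity
  have aRs : |Rs| ≤ Xhi := by rw [abs_of_pos hRs0]; exact hRs.2
  have aRm : |Rm| ≤ Xhi := by rw [abs_of_pos hRm0]; exact hRm.2
  have as : |s| ≤ smax := by rw [abs_of_nonneg hs.1]; exact hs.2
  have am : |m| ≤ smax := by rw [abs_of_nonneg hm.1]; exact hm.2
  have aRs3 : |Rs ^ 3| ≤ Xhi ^ 3 := by rw [abs_of_pos (by positivity)]; exact pow_le_pow_left₀ hRs0.le hRs.2 3
  have aRm3 : |Rm ^ 3| ≤ Xhi ^ 3 := by rw [abs_of_pos (by positivity)]; exact pow_le_pow_left₀ hRm0.le hRm.2 3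
  have dR3 : |Rs ^ 3 - Rm ^ 3| ≤ 3 * Xhi ^ 2 * r := cube_sub_abs_le hRs0.le hRm0.le hRs.2 hRm.2 hR
  have iRs : |1 / Rs| ≤ 1 / Xlo := abs_inv_le_of_le hXlo hRs.1
  have iRm : |1 / Rm| ≤ 1 / Xlo := abs_inv_le_of_le hXlo hRm.1
  have diR : |1 / Rs - 1 / Rm| ≤ r / Xlo ^ 2 := inv_sub_inv_abs_le hXlo hRs.1 hRm.1 hR
  refine ⟨⟨?_, ?_, ?_⟩, ⟨abs_inv_le_of_le hμ hDs.1, abs_inv_le_of_le hμ hDm.1, inv_sub_inv_abs_le hμ hDs.1 hDm.1 hD⟩,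
    ⟨abs_inv_le_of_le hμ2 hGs, abs_inv_le_of_le hμ2 hGm, inv_sub_inv_abs_le hμ2 hGs hGm hG⟩, ⟨?_, ?_, ?_⟩, ⟨?_, ?_, ?_⟩⟩
  · rw [abs_mul]; exact mul_le_mul aRs as (abs_nonneg _) ((abs_nonneg _).trans aRs)
  · rw [abs_mul]; exact mul_le_mul aRm am (abs_nonneg _) ((abs_nonneg _).trans aRm)
  · exact prod2_env aRm as hR hsm
  · rw [abs_mul]; exact mul_le_mul aRs3 as (abs_nonneg _) ((abs_nonneg _).trans aRs3)
  · rw [abs_mul]; exact mul_le_mul aRm3 am (abs_nonneg _) ((abs_nonneg _).trans aRm3)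
  · have := prod2_env aRm3 as dR3 hsm; linarith
  · rw [abs_mul]; exact mul_le_mul as iRs (abs_nonneg _) ((abs_nonneg _).trans as)
  · rw [abs_mul]; exact mul_le_mul am iRm (abs_nonneg _) ((abs_nonneg _).trans am)
  · exact prod2_env am iRs hsm diR

/-- **ENVELOPE OF `K_W`.** -/
theorem envW_bound {θ : ℝ} (hXa : 0 < Xa) (hXB : Xa ≤ XB) (hμ : 0 < μ) (hXlo : 0 < Xlo)
    (hsm : |s - m| ≤ r) (hR : |Rs - Rm| ≤ r) (hD : |Ds - Dm| ≤ M * r) (hF : |Fs - Fm| ≤ M3 * r) (hG : |Gs - Gm| ≤ MG * r)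
    (hDs : μ ≤ Ds ∧ Ds ≤ ν) (hDm : μ ≤ Dm ∧ Dm ≤ ν) (hRs : Xlo ≤ Rs ∧ Rs ≤ Xhi) (hRm : Xlo ≤ Rm ∧ Rm ≤ Xhi)
    (hs : 0 ≤ s ∧ s ≤ smax) (hm : 0 ≤ m ∧ m ≤ smax) (hFs : |Fs| ≤ M) (hFm : |Fm| ≤ M) (hGs : μ ^ 2 ≤ Gs) (hGm : μ ^ 2 ≤ Gm)
    (hcs : |2 * s * Real.cos θ - 2 * m * Real.cos θ| ≤ 2 * r) :
    |((Xa + 2 * s * Real.cos θ) * (1 / Ds ^ 2) - (Rs * s) * Fs * (1 / Ds ^ 3))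
        - ((Xa + 2 * m * Real.cos θ) * (1 / Dm ^ 2) - (Rm * m) * Fm * (1 / Dm ^ 3))|
      ≤ envW XB r M M3 μ ν Xhi smax := by
  obtain ⟨⟨bRs, bRm, dRsm⟩, -, -, -, -⟩ := factor_facts hμ hXlo hsm hR hD hG hDs hDm hRs hRm hs hm hGs hGm
  have hsmax : 0 ≤ smax := hs.1.trans hs.2
  have hDs0 : 0 < Ds := hμ.trans_le hDs.1
  have hν : 0 < ν := hDs0.trans_le hDs.2
  -- first term: (Xa + 2 s cos) / D²
  have iD2 : |1 / Ds ^ 2 - 1 / Dm ^ 2| ≤ 2 * (M * r) * ν / μ ^ 4 := inv_sq_sub_abs_le hμ hDs.1 hDm.1 hDs.2 hDm.2 hD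
  have bD2 : |1 / Ds ^ 2| ≤ 1 / μ ^ 2 := by
    rw [abs_of_pos (by positivity)]; exact one_div_le_one_div_of_le (by positivity) (pow_le_pow_left₀ hμ.le hDs.1 2)
  have blin : |Xa + 2 * m * Real.cos θ| ≤ XB + 2 * smax := by
    have hc := Real.abs_cos_le_one θ
    have : |2 * m * Real.cos θ| ≤ 2 * smax := by
      rw [abs_mul, abs_of_nonneg (by linarith [hm.1] : (0:ℝ) ≤ 2 * m)]
      nlinarith [hm.1, hm.2, abs_nonneg (Real.cos θ)]
    calc |Xa + 2 * m * Real.cos θ| ≤ |Xa| + |2 * m * Real.cos θ| := abs_add_le _ _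
      _ ≤ XB + 2 * smax := by rw [abs_of_pos hXa]; linarith
  have dlin : |(Xa + 2 * s * Real.cos θ) - (Xa + 2 * m * Real.cos θ)| ≤ 2 * r := by
    rw [show (Xa + 2 * s * Real.cos θ) - (Xa + 2 * m * Real.cos θ) = 2 * s * Real.cos θ - 2 * m * Real.cos θ by ring]; exact hcs
  have hA := prod2_env blin bD2 dlin iD2
  -- second term: (R s) · F · (1/D³)
  have iD3 : |1 / Ds ^ 3 - 1 / Dm ^ 3| ≤ 3 * (M * r) * ν ^ 2 / μ ^ 6 := inv_cube_sub_abs_le hμ hDs.1 hDm.1 hDs.2 hDm.2 hD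
  have bD3 : |1 / Ds ^ 3| ≤ 1 / μ ^ 3 := by
    rw [abs_of_pos (by positivity)]; exact one_div_le_one_div_of_le (by positivity) (pow_le_pow_left₀ hμ.le hDs.1 3)
  have hB := prod3_env hFs bD3 bRm hFm dRsm hF iD3
  rw [show ((Xa + 2 * s * Real.cos θ) * (1 / Ds ^ 2) - (Rs * s) * Fs * (1 / Ds ^ 3)) - ((Xa + 2 * m * Real.cos θ) * (1 / Dm ^ 2) - (Rm * m) * Fm * (1 / Dm ^ 3))
    = ((Xa + 2 * s * Real.cos θ) * (1 / Ds ^ 2) - (Xa + 2 * m * Real.cos θ) * (1 / Dm ^ 2)) - ((Rs * s) * Fs * (1 / Ds ^ 3) - (Rm * m) * Fm * (1 / Dm ^ 3)) by ring]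
  unfold envW
  exact (abs_sub _ _).trans (add_le_add hA hB)

/-- **ENVELOPE OF `K_Aσ = R s/(D G)`.** -/
theorem envS_bound (hμ : 0 < μ) (hXlo : 0 < Xlo)
    (hsm : |s - m| ≤ r) (hR : |Rs - Rm| ≤ r) (hD : |Ds - Dm| ≤ M * r) (hG : |Gs - Gm| ≤ MG * r)
    (hDs : μ ≤ Ds ∧ Ds ≤ ν) (hDm : μ ≤ Dm ∧ Dm ≤ ν) (hRs : Xlo ≤ Rs ∧ Rs ≤ Xhi) (hRm : Xlo ≤ Rm ∧ Rm ≤ Xhi)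
    (hs : 0 ≤ s ∧ s ≤ smax) (hm : 0 ≤ m ∧ m ≤ smax) (hGs : μ ^ 2 ≤ Gs) (hGm : μ ^ 2 ≤ Gm) :
    |(Rs * s) * (1 / Ds) * (1 / Gs) - (Rm * m) * (1 / Dm) * (1 / Gm)| ≤ envS r M MG μ Xhi smax := by
  obtain ⟨⟨bRs, bRm, dRsm⟩, ⟨bDs, bDm, dD⟩, ⟨bGs, bGm, dG⟩, -, -⟩ := factor_facts hμ hXlo hsm hR hD hG hDs hDm hRs hRm hs hm hGs hGm
  unfold envS
  exact prod3_env bDs bGs bRm bDm dRsm dD dG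

/-- **ENVELOPE OF `K_R = R³ s/(D G)`.** -/
theorem envR_bound (hμ : 0 < μ) (hXlo : 0 < Xlo)
    (hsm : |s - m| ≤ r) (hR : |Rs - Rm| ≤ r) (hD : |Ds - Dm| ≤ M * r) (hG : |Gs - Gm| ≤ MG * r)
    (hDs : μ ≤ Ds ∧ Ds ≤ ν) (hDm : μ ≤ Dm ∧ Dm ≤ ν) (hRs : Xlo ≤ Rs ∧ Rs ≤ Xhi) (hRm : Xlo ≤ Rm ∧ Rm ≤ Xhi)
    (hs : 0 ≤ s ∧ s ≤ smax) (hm : 0 ≤ m ∧ m ≤ smax) (hGs : μ ^ 2 ≤ Gs) (hGm : μ ^ 2 ≤ Gm) :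
    |(Rs ^ 3 * s) * (1 / Ds) * (1 / Gs) - (Rm ^ 3 * m) * (1 / Dm) * (1 / Gm)| ≤ envR r M MG μ Xhi smax := by
  obtain ⟨-, ⟨bDs, bDm, dD⟩, ⟨bGs, bGm, dG⟩, ⟨bR3s, bR3m, dR3⟩, -⟩ := factor_facts hμ hXlo hsm hR hD hG hDs hDm hRs hRm hs hm hGs hGm
  unfold envR
  exact prod3_env bDs bGs bR3m bDm dR3 dD dG

/-- **ENVELOPE OF `K_B1 = s/(R D G)`.** -/
theorem envB_bound (hμ : 0 < μ) (hXlo : 0 < Xlo)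
    (hsm : |s - m| ≤ r) (hR : |Rs - Rm| ≤ r) (hD : |Ds - Dm| ≤ M * r) (hG : |Gs - Gm| ≤ MG * r)
    (hDs : μ ≤ Ds ∧ Ds ≤ ν) (hDm : μ ≤ Dm ∧ Dm ≤ ν) (hRs : Xlo ≤ Rs ∧ Rs ≤ Xhi) (hRm : Xlo ≤ Rm ∧ Rm ≤ Xhi)
    (hs : 0 ≤ s ∧ s ≤ smax) (hm : 0 ≤ m ∧ m ≤ smax) (hGs : μ ^ 2 ≤ Gs) (hGm : μ ^ 2 ≤ Gm) :
    |(s * (1 / Rs)) * (1 / Ds) * (1 / Gs) - (m * (1 / Rm)) * (1 / Dm) * (1 / Gm)| ≤ envB r M MG μ Xlo smax := by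
  obtain ⟨-, ⟨bDs, bDm, dD⟩, ⟨bGs, bGm, dG⟩, -, ⟨bQs, bQm, dQ⟩⟩ := factor_facts hμ hXlo hsm hR hD hG hDs hDm hRs hRm hs hm hGs hGm
  unfold envB
  exact prod3_env bDs bGs bQm bDm dQ dD dG

end env

end Summit.Ventures.FusionMHD.Models.CFIterLike.QHalf

end
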